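import Summits.Ventures.PercRepro.RankLevelSetHallLostInj
import Summits.Ventures.PercRepro.RankLevelSetRuleQCount

/-!
# PercRepro — THE MEMBER STRUCTURE OF A LOST SET (p4, gen 35; C-044, UP form at the tight layer; paper
proofs/P4-CELL-THREE.md §14.22 (m)–(o))

At the tight layer `#E = p + q` a member `Z` is an independent `q`-set with independent complement
(`compl_indep_of_mem_U`, `ncard_eq_of_mem_cellMembers`: night-1).  The facts below are what a proof of the
per-cyclic-set injection needs about a lost set `S ⊇ Z`:
* `indep_of_mem_cellMembers` — a member is independent;
* `indep_compl_of_mem_lostSets` — the complement of a lost set is independent (it lies in the complement of a member);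
* `mem_of_mem_cellMembers_of_notMem_closure` — a coloop of `S` (an `x ∈ S` outside `cl(S ∖ x)`) lies in every member
  inside `S`: a member is a basis of `S`;
* `eRk_inter_eq_of_subset_union` — the trace of such a basis on a part `C` with `r(C ∪ K) = r C + #K`, `K ⊆ Z`, is a
  basis of `C` (the member `Z = Z_C ∪ K` of a lost set `S = C ⊔ K`);
* `encard_le_two_mul_eRk_of_indep_of_indep_compl` — when the ground set is the union of two independent sets,
  `#X ≤ 2·r(X)` for every `X ⊆ E`; hence `#cl C ≤ 2 r(C)` for the cyclic part of a lost set — only the inequality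
  holds (the triangle witness of §14.22 (m) has `#cl C = 3 = 2 r(C) − 1`).
Axioms: standard.
-/

namespace PercRepro

open Set Matroid

variable {α : Type} (M : Matroid α) [M.Finite]

/-- A member at the tight layer is independent: `r(Z) = q = #Z`. -/
theorem indep_of_mem_cellMembers {p q : ℕ} (hE : M.E.ncard = p + q) {Z : Set α}
    (hZ : Z ∈ cellMembers M p q) : M.Indep Z := by
  have hZfin : Z.Finite := M.set_finite Z hZ.1
  rw [indep_iff_eRk_eq_encard_of_finite hZfin, hZ.2.1, ← hZfin.cast_ncard_eq,
    ncard_eq_of_mem_cellMembers M hE hZ]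

/-- The complement of a lost set is independent: it lies inside the complement of a member. -/
theorem indep_compl_of_mem_lostSets {p q : ℕ} (hE : M.E.ncard = p + q) {S : Set α}
    (hS : S ∈ lostSets M p q) : M.Indep (M.E \ S) := by
  obtain ⟨-, -, -, -, Z, hZ, hZS⟩ := hS
  obtain ⟨hind, -⟩ := compl_indep_of_mem_U M hE hZ
  exact hind.subset (sdiff_subset_sdiff_right hZS)

omit [M.Finite] in
/-- A coloop of `S` — an `x ∈ S` with `x ∉ cl(S ∖ x)` — lies in every subset `Z ⊆ S` of the same rank
(in particular in every member inside a lost set): otherwise `Z ⊆ S ∖ x` has rank `< r(S)`. -/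
theorem mem_of_eRk_eq_of_notMem_closure {S Z : Set α} (hSE : S ⊆ M.E) (hZS : Z ⊆ S)
    (hZ : M.eRk Z = M.eRk S) (hS : M.eRk S ≠ ⊤) {x : α} (hxS : x ∈ S)
    (hx : x ∉ M.closure (S \ {x})) : x ∈ Z := by
  by_contra hxZ
  have h1 : M.eRk S = M.eRk (S \ {x}) + 1 := by
    rw [← eRk_insert_eq_add_one ⟨hSE hxS, hx⟩, insert_sdiff_singleton, insert_eq_of_mem hxS]
  have h2 : M.eRk Z ≤ M.eRk (S \ {x}) := M.eRk_mono (subset_sdiff_singleton hZS hxZ)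
  have hfin : M.eRk (S \ {x}) ≠ ⊤ := fun h => hS (by rw [h1, h, top_add])
  obtain ⟨c, hc⟩ : ∃ c : ℕ, M.eRk (S \ {x}) = c := ⟨_, (ENat.coe_toNat hfin).symm⟩
  rw [hZ, h1, hc] at h2
  rw [hc] at h1
  have : (c : ℕ∞) + 1 ≤ c := h2
  have h3 : c + 1 ≤ c := by exact_mod_cast this
  omega

omit [M.Finite] in
/-- A coloop of a lost set lies in every member inside it. -/
theorem mem_of_mem_cellMembers_of_notMem_closure {p q : ℕ} {S Z : Set α} (hS : S ∈ lostSets M p q)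
    (hZ : Z ∈ cellMembers M p q) (hZS : Z ⊆ S) {x : α} (hxS : x ∈ S)
    (hx : x ∉ M.closure (S \ {x})) : x ∈ Z := by
  refine mem_of_eRk_eq_of_notMem_closure M hS.1 hZS ?_ ?_ hxS hx
  · rw [hZ.2.1, hS.2.1]
  · rw [hS.2.1]; exact ENat.coe_ne_top q

omit [M.Finite] in
/-- If `K ⊆ Z ⊆ C ∪ K`, `K` finite, and `Z` has the rank `r(C ∪ K) = r(C) + #K` of the whole, then the trace
`Z ∩ C` has the rank of `C`: `r(Z) ≤ r(Z ∩ C) + #K`. -/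
theorem eRk_inter_eq_of_subset_union {C K Z : Set α} (hKfin : K.Finite) (hKZ : K ⊆ Z) (hZ : Z ⊆ C ∪ K)
    (hCK : M.eRk (C ∪ K) = M.eRk C + K.ncard) (hZr : M.eRk Z = M.eRk (C ∪ K)) (hCtop : M.eRk C ≠ ⊤) :
    M.eRk (Z ∩ C) = M.eRk C := by
  refine le_antisymm (M.eRk_mono inter_subset_right) ?_
  have hZeq : Z = (Z ∩ C) ∪ K := by
    ext y
    constructor
    · intro hy
      rcases hZ hy with hyC | hyK
      · exact Or.inl ⟨hy, hyC⟩
      · exact Or.inr hyK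
    · rintro (hy | hy)
      · exact hy.1
      · exact hKZ hy
  have h1 : M.eRk ((Z ∩ C) ∪ K) ≤ M.eRk (Z ∩ C) + K.encard := M.eRk_union_le_eRk_add_encard _ _
  rw [← hZeq] at h1
  rw [← hKfin.cast_ncard_eq, hZr, hCK] at h1
  have hZCtop : M.eRk (Z ∩ C) ≠ ⊤ :=
    fun h => hCtop (eq_top_iff.2 (h ▸ M.eRk_mono inter_subset_right))
  obtain ⟨a, ha⟩ : ∃ a : ℕ, M.eRk (Z ∩ C) = a := ⟨_, (ENat.coe_toNat hZCtop).symm⟩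
  obtain ⟨c, hc⟩ : ∃ c : ℕ, M.eRk C = c := ⟨_, (ENat.coe_toNat hCtop).symm⟩
  rw [ha, hc] at h1
  rw [ha, hc]
  have h2 : c + K.ncard ≤ a + K.ncard := by exact_mod_cast h1
  exact_mod_cast (by omega : c ≤ a)

omit [M.Finite] in
/-- When the ground set is the union of two independent sets `Z` and `E ∖ Z`, every `X ⊆ E` satisfies
`#X ≤ 2·r(X)`: `X = (X ∩ Z) ∪ (X ∖ Z)` with both parts independent subsets of `X`. -/
theorem encard_le_two_mul_eRk_of_indep_of_indep_compl {Z : Set α} (hZ : M.Indep Z) (hZc : M.Indep (M.E \ Z))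
    {X : Set α} (hX : X ⊆ M.E) : X.encard ≤ 2 * M.eRk X := by
  have h1 : (X ∩ Z).encard ≤ M.eRk X :=
    (hZ.subset inter_subset_right).encard_le_eRk_of_subset inter_subset_left
  have h2 : (X \ Z).encard ≤ M.eRk X :=
    (hZc.subset (sdiff_subset_sdiff_left hX)).encard_le_eRk_of_subset sdiff_subset
  calc X.encard = ((X ∩ Z) ∪ (X \ Z)).encard := by rw [inter_union_sdiff]
    _ ≤ (X ∩ Z).encard + (X \ Z).encard := encard_union_le _ _
    _ ≤ M.eRk X + M.eRk X := add_le_add h1 h2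
    _ = 2 * M.eRk X := (two_mul _).symm

/-- At the tight layer, every `X ⊆ E` satisfies `#X ≤ 2·r(X)` as soon as a member exists — in particular the closure
of the cyclic part of a lost set has at most `2 r(C)` elements. -/
theorem encard_le_two_mul_eRk_of_mem_cellMembers {p q : ℕ} (hE : M.E.ncard = p + q) {Z : Set α}
    (hZ : Z ∈ cellMembers M p q) {X : Set α} (hX : X ⊆ M.E) : X.encard ≤ 2 * M.eRk X :=
  encard_le_two_mul_eRk_of_indep_of_indep_compl M (indep_of_mem_cellMembers M hE hZ)
    (compl_indep_of_mem_U M hE hZ).1 hX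

end PercRepro
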